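import Summits.Ventures.CertifiedManyBodySolver.Upper.IntervalReaderAutomaton
import Summits.Ventures.CertifiedManyBodySolver.Upper.IntervalReaderGraphEnergy

/-!
# Ventures/CertifiedManyBodySolver — Upper/IntervalReaderPathSums.lean: path sums of depth-one automata
(part 13 of the Theorem-H1′ package; parts 1–12: `IntervalReaderSchur` … `IntervalReaderEnclosure`)

HONEST FRAMING: first certified bounds; not a superconductivity verdict; every number certified or labelled
float.  Pure algebra (entries of an ordered product of matrices); no number is certified here, no row moves,
nothing is said about the Hubbard model, a producer or the thermodynamic limit.

Part 7 (`IntervalReaderAutomaton`) defined the kernel `automatonKernel L O σ τ : Matrix β β ℂ` of a finite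
automaton with site operators `O k b c` — the ordered product of the `β × β` matrices `(b, c) ↦ O k b c (σ k) (τ k)`
— and reduced «E1's multi-state MPO represents `den · H`» to a claim about its `(START, FINAL)` entry.  E1's own
sentence (`hubbard_mpo.py`): «`den*H` = sum over `START → … → FINAL` paths of the ordered tensor product of the
`O`'s».  This file proves the closed forms of those path sums for automata of DEPTH ONE — a source `s₀`, an
absorbing sink `f`, and channels that move only to themselves or to `f` (the shape of `hubbard_mpo.py`: `START`,
`FINAL`, one channel per open hopping end):

* `spliceFamily pre k mid post` — the site family «`pre` before `k`, `mid` at `k`, `post` after `k`», with its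
  peeling lemmas at site `0`, and `productOp_cons_cons` (an entry of `⨂ u` splits off its first factor);
* `automatonKernel_absorbing_apply` — `K(f, f) = ⨂_k O k f f`;
* `automatonKernel_channel_apply` — `K(b, f) = Σ_{k′} ⨂[O j b b (j<k′) | O k′ b f | O j f f (j>k′)]` (a channel
  runs, closes ONCE, then only `f`-loops follow);
* `automatonKernel_source_apply` — `K(s₀, f) = Σ_k ⨂[s₀-loops | O k s₀ f | f-loops]`
  `+ Σ_{k<k′} Σ_{b ≠ s₀,f} ⨂[s₀-loops | O k s₀ b | b-loops | O k′ b f | f-loops]`: every accepted path is a direct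
  jump or ONE excursion through ONE channel (induction on the sites, peeling site `0` with part 7's
  `automatonKernel_succ_cons`);
* for part 14/15's use: `productOp` entries with a zero factor vanish, site-wise scalars come out as their product,
  a constant splice is a one-site `Function.update`; and the HOPPING WORDS of part 9 AS SPLICES —
  `hopFamily_eq_spliceFamily` (`c†_{kσ} c_{k′σ′}`, `k < k′`: `1 | c†_σ F | F … F | c_{σ′} | 1`) and
  `hopFamily_eq_spliceFamily'` (`c†_{k′σ′} c_{kσ}`: `1 | F c_σ | F … F | c†_{σ′} | 1`), i.e. exactly the open / pass /
  close rows of E1's `dag` / `ann` channels; `sum_sum_eq_sum_sum_lt` folds an ordered double sum onto pairs `x < y`.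
-/

noncomputable section

open Matrix Finset
open scoped BigOperators ComplexOrder

namespace Summit.Ventures.CertifiedManyBodySolver.Upper.IntervalReader

open Literature.MathematicalPhysics.QuantumLattice
open Literature.MathematicalPhysics.QuantumLattice.JordanWigner

variable {q : ℕ} {β : Type*} [Fintype β] [DecidableEq β]

/-! ## §AA  Path sums of depth-one automata -/

/-- The site family «`pre` strictly before position `k`, `mid` at `k`, `post` strictly after `k`». -/
def spliceFamily {L : ℕ} {M : Type*} (pre : Fin L → M) (k : Fin L) (mid : M) (post : Fin L → M) :
    Fin L → M :=
  fun j => if j < k then pre j else if j = k then mid else post j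

/-- Splicing at position `0`, read at `0`: the middle. -/
theorem spliceFamily_zero_zero {L : ℕ} {M : Type*} (pre : Fin (L + 1) → M) (mid : M)
    (post : Fin (L + 1) → M) : spliceFamily pre 0 mid post 0 = mid := by
  simp [spliceFamily]

/-- Splicing at position `0`, read after `0`: the tail family. -/
theorem spliceFamily_zero_succ {L : ℕ} {M : Type*} (pre : Fin (L + 1) → M) (mid : M)
    (post : Fin (L + 1) → M) (i : Fin L) : spliceFamily pre 0 mid post i.succ = post i.succ := by
  simp [spliceFamily, Fin.succ_ne_zero]

/-- Splicing after position `0`, read at `0`: the head family. -/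
theorem spliceFamily_succ_zero {L : ℕ} {M : Type*} (pre : Fin (L + 1) → M) (k : Fin L) (mid : M)
    (post : Fin (L + 1) → M) : spliceFamily pre k.succ mid post 0 = pre 0 := by
  simp [spliceFamily, Fin.succ_pos]

/-- Splicing after position `0`, read after `0`: the splice of the shifted families. -/
theorem spliceFamily_succ_succ {L : ℕ} {M : Type*} (pre : Fin (L + 1) → M) (k : Fin L) (mid : M)
    (post : Fin (L + 1) → M) (i : Fin L) :
    spliceFamily pre k.succ mid post i.succ =
      spliceFamily (fun j => pre j.succ) k mid (fun j => post j.succ) i := by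
  simp only [spliceFamily, Fin.succ_lt_succ_iff, Fin.succ_inj]

/-- A product operator's entry splits off its first factor. -/
theorem productOp_cons_cons (L : ℕ) (u : Fin (L + 1) → Matrix (Fin q) (Fin q) ℂ) (s s' : Fin q)
    (σ τ : TensorIndex (Fin L) q) :
    productOp u (Fin.cons s σ : Fin (L + 1) → Fin q) (Fin.cons s' τ : Fin (L + 1) → Fin q) =
      u 0 s s' * productOp (fun i => u i.succ) σ τ := by
  rw [productOp_apply, productOp_apply, Fin.prod_univ_succ]
  simp only [Fin.cons_zero, Fin.cons_succ]

/-- An ENTRY of the automaton kernel, peeled at the first site: `K_{L+1}(s∷σ, s′∷τ)(b, c) =`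
`Σ_{b₁} O 0 b b₁ s s′ · K_L(σ, τ)(b₁, c)` on the shifted table. -/
theorem automatonKernel_succ_cons_apply (L : ℕ) (O : Fin (L + 1) → β → β → Matrix (Fin q) (Fin q) ℂ)
    (s s' : Fin q) (σ τ : TensorIndex (Fin L) q) (b c : β) :
    automatonKernel (L + 1) O (Fin.cons s σ : Fin (L + 1) → Fin q) (Fin.cons s' τ : Fin (L + 1) → Fin q) b c =
      ∑ b₁, O 0 b b₁ s s' * automatonKernel L (fun k => O k.succ) σ τ b₁ c := by
  rw [automatonKernel_succ_cons, Matrix.mul_apply]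
  rfl

/-- **Absorbing state.**  If `f` is absorbing (`O k f c = 0` for `c ≠ f`), the kernel entry `(f, f)` is the product
operator of the `f`-loops: `K(f, f) = ⨂_k O k f f` (for E1's `FINAL`: `⨂ 1 = 1`). -/
theorem automatonKernel_absorbing_apply : ∀ (L : ℕ) (O : Fin L → β → β → Matrix (Fin q) (Fin q) ℂ) (f : β)
    (_hf : ∀ k c, c ≠ f → O k f c = 0) (σ τ : TensorIndex (Fin L) q),
    automatonKernel L O σ τ f f = productOp (fun k => O k f f) σ τ
  | 0, O, f, _, σ, τ => by
    rw [automatonKernel_zero, productOp_apply, Fintype.prod_empty, Matrix.one_apply_eq]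
  | L + 1, O, f, hf, σ, τ => by
    obtain ⟨s, σ, rfl⟩ : ∃ s σ', σ = (Fin.cons s σ' : Fin (L + 1) → Fin q) :=
      ⟨σ 0, Fin.tail σ, (Fin.cons_self_tail σ).symm⟩
    obtain ⟨s', τ, rfl⟩ : ∃ s' τ', τ = (Fin.cons s' τ' : Fin (L + 1) → Fin q) :=
      ⟨τ 0, Fin.tail τ, (Fin.cons_self_tail τ).symm⟩
    have ih := automatonKernel_absorbing_apply L (fun k => O k.succ) f (fun k c hc => hf k.succ c hc) σ τ
    rw [automatonKernel_succ_cons_apply, productOp_cons_cons,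
      Fintype.sum_eq_single f (fun b hb => by rw [hf 0 b hb, Matrix.zero_apply, zero_mul]), ih]

/-- **Channel to sink.**  If `f` is absorbing and the channel `b ≠ f` moves only to itself or to `f`, then
`K(b, f) = Σ_{k′} ⨂ [O j b b (j < k′) | O k′ b f | O j f f (j > k′)]`: the channel runs until it closes ONCE. -/
theorem automatonKernel_channel_apply : ∀ (L : ℕ) (O : Fin L → β → β → Matrix (Fin q) (Fin q) ℂ) (b f : β)
    (_hbf : b ≠ f) (_hf : ∀ k c, c ≠ f → O k f c = 0) (_hb : ∀ k c, c ≠ b → c ≠ f → O k b c = 0)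
    (σ τ : TensorIndex (Fin L) q),
    automatonKernel L O σ τ b f =
      ∑ k, productOp (spliceFamily (fun j => O j b b) k (O k b f) (fun j => O j f f)) σ τ
  | 0, O, b, f, hbf, _, _, σ, τ => by
    rw [automatonKernel_zero, Matrix.one_apply_ne hbf, Fintype.sum_empty]
  | L + 1, O, b, f, hbf, hf, hb, σ, τ => by
    obtain ⟨s, σ, rfl⟩ : ∃ s σ', σ = (Fin.cons s σ' : Fin (L + 1) → Fin q) :=
      ⟨σ 0, Fin.tail σ, (Fin.cons_self_tail σ).symm⟩
    obtain ⟨s', τ, rfl⟩ : ∃ s' τ', τ = (Fin.cons s' τ' : Fin (L + 1) → Fin q) :=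
      ⟨τ 0, Fin.tail τ, (Fin.cons_self_tail τ).symm⟩
    have ihb := automatonKernel_channel_apply L (fun k => O k.succ) b f hbf (fun k c hc => hf k.succ c hc)
      (fun k c h1 h2 => hb k.succ c h1 h2) σ τ
    have ihf := automatonKernel_absorbing_apply L (fun k => O k.succ) f (fun k c hc => hf k.succ c hc) σ τ
    rw [automatonKernel_succ_cons_apply,
      Fintype.sum_eq_add b f hbf (fun c hc => by rw [hb 0 c hc.1 hc.2, Matrix.zero_apply, zero_mul]),
      ihb, ihf, Fin.sum_univ_succ, productOp_cons_cons, spliceFamily_zero_zero]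
    simp only [productOp_cons_cons, spliceFamily_succ_zero, spliceFamily_zero_succ, spliceFamily_succ_succ]
    rw [Finset.mul_sum, add_comm]

/-- Splitting a finite sum at two distinguished indices. -/
private theorem sum_split_two {E : Type*} [AddCommMonoid E] (a a' : β) (haa : a ≠ a') (g : β → E) :
    ∑ c, g c = g a + g a' + ∑ c, if c ≠ a ∧ c ≠ a' then g c else 0 := by
  have h : ∀ c, g c = ((if c = a then g c else 0) + (if c = a' then g c else 0)) +
      (if c ≠ a ∧ c ≠ a' then g c else 0) := by
    intro c
    by_cases hca : c = a
    · subst hca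
      simp [haa]
    · by_cases hca' : c = a'
      · subst hca'
        simp [hca]
      · simp [hca, hca']
  calc ∑ c, g c = ∑ c, (((if c = a then g c else 0) + (if c = a' then g c else 0)) +
        (if c ≠ a ∧ c ≠ a' then g c else 0)) := Finset.sum_congr rfl fun c _ => h c
    _ = g a + g a' + ∑ c, if c ≠ a ∧ c ≠ a' then g c else 0 := by
        rw [Finset.sum_add_distrib, Finset.sum_add_distrib, Finset.sum_ite_eq' Finset.univ a,
          Finset.sum_ite_eq' Finset.univ a']
        simp

/-- **Source to sink — every accepted path is a direct jump or one excursion through one channel.**  If `f` is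
absorbing and every state other than `s₀, f` moves only to itself or to `f`, then
`K(s₀, f) = Σ_k ⨂[O j s₀ s₀ (j<k) | O k s₀ f | O j f f (j>k)]`
`        + Σ_{k<k′} Σ_{b ≠ s₀, f} ⨂[O j s₀ s₀ (j<k) | O k s₀ b | O j b b (k<j<k′) | O k′ b f | O j f f (j>k′)]`.
(E1: `den*H = sum over START->...->FINAL paths of the ordered tensor product of the O's`.) -/
theorem automatonKernel_source_apply : ∀ (L : ℕ) (O : Fin L → β → β → Matrix (Fin q) (Fin q) ℂ) (s₀ f : β)
    (_hsf : s₀ ≠ f) (_hf : ∀ k c, c ≠ f → O k f c = 0)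
    (_hch : ∀ k b c, b ≠ s₀ → b ≠ f → c ≠ b → c ≠ f → O k b c = 0)
    (σ τ : TensorIndex (Fin L) q),
    automatonKernel L O σ τ s₀ f =
      ∑ k, productOp (spliceFamily (fun j => O j s₀ s₀) k (O k s₀ f) (fun j => O j f f)) σ τ +
      ∑ k, ∑ k', ∑ b, if k < k' ∧ b ≠ s₀ ∧ b ≠ f then
        productOp (spliceFamily (fun j => O j s₀ s₀) k (O k s₀ b)
          (spliceFamily (fun j => O j b b) k' (O k' b f) (fun j => O j f f))) σ τ else 0
  | 0, O, s₀, f, hsf, _, _, σ, τ => by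
    rw [automatonKernel_zero, Matrix.one_apply_ne hsf, Fintype.sum_empty, Fintype.sum_empty, add_zero]
  | L + 1, O, s₀, f, hsf, hf, hch, σ, τ => by
    obtain ⟨s, σ, rfl⟩ : ∃ s σ', σ = (Fin.cons s σ' : Fin (L + 1) → Fin q) :=
      ⟨σ 0, Fin.tail σ, (Fin.cons_self_tail σ).symm⟩
    obtain ⟨s', τ, rfl⟩ : ∃ s' τ', τ = (Fin.cons s' τ' : Fin (L + 1) → Fin q) :=
      ⟨τ 0, Fin.tail τ, (Fin.cons_self_tail τ).symm⟩
    -- the three kinds of kernel entries of the shifted automaton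
    have ihs := automatonKernel_source_apply L (fun k => O k.succ) s₀ f hsf (fun k c hc => hf k.succ c hc)
      (fun k b c h1 h2 h3 h4 => hch k.succ b c h1 h2 h3 h4) σ τ
    have ihf := automatonKernel_absorbing_apply L (fun k => O k.succ) f (fun k c hc => hf k.succ c hc) σ τ
    have ihb : ∀ b, b ≠ s₀ → b ≠ f → automatonKernel L (fun k => O k.succ) σ τ b f =
        ∑ k, productOp (spliceFamily (fun j => O j.succ b b) k (O k.succ b f) (fun j => O j.succ f f)) σ τ :=
      fun b hbs hbf => automatonKernel_channel_apply L (fun k => O k.succ) b f hbf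
        (fun k c hc => hf k.succ c hc) (fun k c h1 h2 => hch k.succ b c hbs hbf h1 h2) σ τ
    -- (1) the left-hand side, peeled at site `0` and split by the first state visited
    rw [automatonKernel_succ_cons_apply, sum_split_two s₀ f hsf, ihs, ihf]
    have hthird : (∑ c, if c ≠ s₀ ∧ c ≠ f then
          O 0 s₀ c s s' * automatonKernel L (fun k => O k.succ) σ τ c f else 0) =
        ∑ c, if c ≠ s₀ ∧ c ≠ f then O 0 s₀ c s s' *
          ∑ k, productOp (spliceFamily (fun j => O j.succ c c) k (O k.succ c f) (fun j => O j.succ f f)) σ τ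
          else 0 := by
      refine Finset.sum_congr rfl fun c _ => ?_
      split_ifs with hc
      · rw [ihb c hc.1 hc.2]
      · rfl
    rw [hthird]
    -- (2) the right-hand side, peeled at site `0`: the direct part
    have hdirect : (∑ k : Fin (L + 1), productOp (spliceFamily (fun j => O j s₀ s₀) k (O k s₀ f) (fun j => O j f f))
          (Fin.cons s σ : Fin (L + 1) → Fin q) (Fin.cons s' τ : Fin (L + 1) → Fin q)) =
        O 0 s₀ f s s' * productOp (fun k => O k.succ f f) σ τ +
          O 0 s₀ s₀ s s' * ∑ k, productOp (spliceFamily (fun j => O j.succ s₀ s₀) k (O k.succ s₀ f)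
            (fun j => O j.succ f f)) σ τ := by
      rw [Fin.sum_univ_succ, productOp_cons_cons, spliceFamily_zero_zero]
      simp only [productOp_cons_cons, spliceFamily_succ_zero, spliceFamily_zero_succ, spliceFamily_succ_succ]
      rw [Finset.mul_sum]
    -- (3) the excursions opened at site `0`
    have hk0 : (∑ k' : Fin (L + 1), ∑ b, if (0 : Fin (L + 1)) < k' ∧ b ≠ s₀ ∧ b ≠ f then
          productOp (spliceFamily (fun j => O j s₀ s₀) 0 (O 0 s₀ b)
            (spliceFamily (fun j => O j b b) k' (O k' b f) (fun j => O j f f)))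
            (Fin.cons s σ : Fin (L + 1) → Fin q) (Fin.cons s' τ : Fin (L + 1) → Fin q) else 0) =
        ∑ c, if c ≠ s₀ ∧ c ≠ f then O 0 s₀ c s s' *
          ∑ k, productOp (spliceFamily (fun j => O j.succ c c) k (O k.succ c f) (fun j => O j.succ f f)) σ τ
          else 0 := by
      rw [Fin.sum_univ_succ]
      simp only [lt_irrefl, false_and, if_false, Finset.sum_const_zero, zero_add, Fin.succ_pos, true_and,
        productOp_cons_cons, spliceFamily_zero_zero, spliceFamily_zero_succ, spliceFamily_succ_succ]
      rw [Finset.sum_comm]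
      refine Finset.sum_congr rfl fun c _ => ?_
      split_ifs with hc
      · rw [Finset.mul_sum]
      · simp
    -- (4) the excursions opened after site `0`
    have hksucc : ∀ i : Fin L, (∑ k' : Fin (L + 1), ∑ b, if i.succ < k' ∧ b ≠ s₀ ∧ b ≠ f then
          productOp (spliceFamily (fun j => O j s₀ s₀) i.succ (O i.succ s₀ b)
            (spliceFamily (fun j => O j b b) k' (O k' b f) (fun j => O j f f)))
            (Fin.cons s σ : Fin (L + 1) → Fin q) (Fin.cons s' τ : Fin (L + 1) → Fin q) else 0) =
        O 0 s₀ s₀ s s' * ∑ k', ∑ b, if i < k' ∧ b ≠ s₀ ∧ b ≠ f then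
          productOp (spliceFamily (fun j => O j.succ s₀ s₀) i (O i.succ s₀ b)
            (spliceFamily (fun j => O j.succ b b) k' (O k'.succ b f) (fun j => O j.succ f f))) σ τ else 0 := by
      intro i
      rw [Fin.sum_univ_succ]
      simp only [Fin.not_lt_zero, false_and, if_false, Finset.sum_const_zero, zero_add, Fin.succ_lt_succ_iff,
        productOp_cons_cons, spliceFamily_succ_zero, spliceFamily_succ_succ]
      rw [Finset.mul_sum]
      refine Finset.sum_congr rfl fun k' _ => ?_
      rw [Finset.mul_sum]
      refine Finset.sum_congr rfl fun c _ => ?_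
      split_ifs <;> simp
    rw [hdirect, Fin.sum_univ_succ, hk0, Finset.sum_congr rfl fun i _ => hksucc i, ← Finset.mul_sum]
    -- (5) bookkeeping
    simp only [mul_add]
    abel

/-- A product family with a zero factor at the spliced position is the zero operator entrywise. -/
theorem productOp_spliceFamily_zero_apply {L : ℕ} (pre post : Fin L → Matrix (Fin q) (Fin q) ℂ) (k : Fin L)
    (σ τ : TensorIndex (Fin L) q) : productOp (spliceFamily pre k 0 post) σ τ = 0 := by
  rw [productOp_apply]
  exact Finset.prod_eq_zero (Finset.mem_univ k) (by simp [spliceFamily])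

/-- A product family with a zero factor anywhere is the zero operator entrywise. -/
theorem productOp_apply_eq_zero_of_apply {L : ℕ} (u : Fin L → Matrix (Fin q) (Fin q) ℂ) {j : Fin L}
    (hj : u j = 0) (σ τ : TensorIndex (Fin L) q) : productOp u σ τ = 0 := by
  rw [productOp_apply]
  exact Finset.prod_eq_zero (Finset.mem_univ j) (by simp [hj])

/-- Site-wise scalars come out of a product operator as their product. -/
theorem productOp_smul_family_apply {L : ℕ} (c : Fin L → ℂ) (u : Fin L → Matrix (Fin q) (Fin q) ℂ)
    (σ τ : TensorIndex (Fin L) q) : productOp (fun j => c j • u j) σ τ = (∏ j, c j) * productOp u σ τ := by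
  rw [productOp_apply, productOp_apply, ← Finset.prod_mul_distrib]
  exact Finset.prod_congr rfl fun j _ => by rw [Matrix.smul_apply, smul_eq_mul]

/-- Splicing a constant family with itself is a one-site update. -/
theorem spliceFamily_const_eq_update {L : ℕ} {M : Type*} (a : M) (k : Fin L) (m : M) :
    spliceFamily (fun _ => a) k m (fun _ => a) = Function.update (fun _ => a) k m := by
  funext j
  by_cases hj : j = k
  · subst hj
    simp [spliceFamily]
  · simp [spliceFamily, hj]

/-! ## §AB  Hopping words as splices; ordered pairs -/

section Pairs

variable {N : ℕ}

/-- The hopping word `c†_{kσ} c_{k′σ′}` (`k < k′`) as a splice: `1` before `k`, `c†_σ F` at `k`, `F` strictly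
between, `c_{σ′}` at `k′`, `1` after. -/
theorem hopFamily_eq_spliceFamily {k k' : Fin N} (hkk' : k < k') (σ σ' : Fin 2) :
    hopFamily k k' σ σ' = spliceFamily (fun _ => 1) k (siteCreation σ * siteParity)
      (spliceFamily (fun _ => siteParity) k' (siteAnnihilation σ') (fun _ => 1)) := by
  funext j
  simp only [hopFamily, spliceFamily, Function.update_apply]
  rcases lt_trichotomy j k with hjk | rfl | hkj
  · have h1 : j ≠ k := ne_of_lt hjk
    have h2 : j ≠ k' := ne_of_lt (hjk.trans hkk')
    have h3 : ¬ k ≤ j := not_le.mpr hjk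
    have h4 : ¬ k' ≤ j := not_le.mpr (hjk.trans hkk')
    simp [h1, h2, h3, h4, hjk]
  · have h2 : j ≠ k' := ne_of_lt hkk'
    have h4 : ¬ k' ≤ j := not_le.mpr hkk'
    simp [h2, h4, hkk']
  · have h1 : j ≠ k := ne_of_gt hkj
    have h5 : ¬ j < k := not_lt.mpr hkj.le
    rcases lt_trichotomy j k' with hjk' | rfl | hk'j
    · have h2 : j ≠ k' := ne_of_lt hjk'
      have h4 : ¬ k' ≤ j := not_le.mpr hjk'
      simp [h1, h2, h4, h5, hjk', hkj.le]
    · simp [h1, h5, hkj.le]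
    · have h2 : j ≠ k' := ne_of_gt hk'j
      have h6 : ¬ j < k' := not_lt.mpr hk'j.le
      simp [h1, h2, h5, h6, hkj.le, hk'j.le]

/-- The hopping word `c†_{k′σ′} c_{kσ}` (`k < k′`) as a splice: `1` before `k`, `F c_σ` at `k`, `F` strictly between,
`c†_{σ′}` at `k′`, `1` after. -/
theorem hopFamily_eq_spliceFamily' {k k' : Fin N} (hkk' : k < k') (σ σ' : Fin 2) :
    hopFamily k' k σ' σ = spliceFamily (fun _ => 1) k (siteParity * siteAnnihilation σ)
      (spliceFamily (fun _ => siteParity) k' (siteCreation σ') (fun _ => 1)) := by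
  funext j
  simp only [hopFamily, spliceFamily, Function.update_apply]
  rcases lt_trichotomy j k with hjk | rfl | hkj
  · have h1 : j ≠ k := ne_of_lt hjk
    have h2 : j ≠ k' := ne_of_lt (hjk.trans hkk')
    have h3 : ¬ k ≤ j := not_le.mpr hjk
    have h4 : ¬ k' ≤ j := not_le.mpr (hjk.trans hkk')
    simp [h1, h2, h3, h4, hjk]
  · have h2 : j ≠ k' := ne_of_lt hkk'
    have h4 : ¬ k' ≤ j := not_le.mpr hkk'
    simp [h2, h4, hkk']
  · have h1 : j ≠ k := ne_of_gt hkj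
    have h5 : ¬ j < k := not_lt.mpr hkj.le
    rcases lt_trichotomy j k' with hjk' | rfl | hk'j
    · have h2 : j ≠ k' := ne_of_lt hjk'
      have h4 : ¬ k' ≤ j := not_le.mpr hjk'
      simp [h1, h2, h4, h5, hjk', hkj.le]
    · simp [h1, h5, hkj.le]
    · have h2 : j ≠ k' := ne_of_gt hk'j
      have h6 : ¬ j < k' := not_lt.mpr hk'j.le
      simp [h1, h2, h5, h6, hkj.le, hk'j.le]

/-- An ordered double sum with vanishing diagonal, folded onto the pairs `x < y`. -/
theorem sum_sum_eq_sum_sum_lt {E : Type*} [AddCommMonoid E] (f : Fin N → Fin N → E) (hdiag : ∀ x, f x x = 0) :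
    ∑ x, ∑ y, f x y = ∑ x, ∑ y, if x < y then f x y + f y x else 0 := by
  have hsplit : ∀ x y, f x y = (if x < y then f x y else 0) + (if y < x then f x y else 0) := by
    intro x y
    rcases lt_trichotomy x y with h | rfl | h
    · simp [h, not_lt.mpr h.le]
    · simp [hdiag]
    · simp [h, not_lt.mpr h.le]
  have hswap : (∑ x, ∑ y, if y < x then f x y else 0) = ∑ x, ∑ y, if x < y then f y x else 0 := by
    rw [Finset.sum_comm]
  calc ∑ x, ∑ y, f x y
      = ∑ x, ∑ y, ((if x < y then f x y else 0) + (if y < x then f x y else 0)) :=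
        Finset.sum_congr rfl fun x _ => Finset.sum_congr rfl fun y _ => hsplit x y
    _ = (∑ x, ∑ y, if x < y then f x y else 0) + ∑ x, ∑ y, if x < y then f y x else 0 := by
        rw [← hswap, ← Finset.sum_add_distrib]
        exact Finset.sum_congr rfl fun x _ => Finset.sum_add_distrib
    _ = ∑ x, ∑ y, if x < y then f x y + f y x else 0 := by
        rw [← Finset.sum_add_distrib]
        refine Finset.sum_congr rfl fun x _ => ?_
        rw [← Finset.sum_add_distrib]
        refine Finset.sum_congr rfl fun y _ => ?_
        split_ifs <;> simp

end Pairs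

end Summit.Ventures.CertifiedManyBodySolver.Upper.IntervalReader

end
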